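import Literature.MathematicalPhysics.KineticTheory.DiPernaLionsScheme
import Literature.Analysis.FluidPDE.SphereMeasureSymmetry
import HarnessLib

/-!
# Symmetrisation and truncation of smooth collision kernels (CIP 1994 §5.3 Steps 6–7)

Topic: MathematicalPhysics / KineticTheory. Second file towards the named fact
`kernel_approximation` (`DiPernaLionsScheme.lean`). For a Galilean-invariant kernel
`B(v, v_*, ω) = b(v - v_*, ω)` the two micro-reversibility symmetries of
`KineticTheory.IsDiPernaLionsKernel` (`collide_neg`, `swap_neg`) read `b ∘ g₁ = b = b ∘ g₂` for the
commuting involutions `g₁ : (z, ω) ↦ (z - 2⟨z,ω⟩ω, -ω)`, `g₂ : (z, ω) ↦ (-z, -ω)` of `E × S^{d-1}`.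
Everything is proved; the file declares theorems only.

* The reflection `R_ω z = z - 2⟨z,ω⟩ω`: involution, `⟨R_ω z, ω⟩ = -⟨z,ω⟩`, isometry,
  `R_ω = -reflection(ℝω)` (`reflectDir_eq_neg_reflection`), hence Lebesgue-measure preserving;
  `g₁`, `g₂`, `g₁g₂` preserve `dz dσ` (`measurePreserving_reflectDir_negDir`, `…_neg_negDir`,
  `…_neg_reflectDir`; skew products over the antipodal symmetry `measurePreserving_neg_sphere`).
* `lintegral_abs_symmetrise_sub_le`: symmetrising `b` over the group does not increase the
  `L¹(dz dσ)` distance to a symmetric kernel.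
* `exists_smooth_radial_cutoff`, `exists_smooth_grazing_cutoff` (`Real.smoothTransition`).
* `exists_symmetrised_truncated_kernel`: from a smooth bounded `b ≥ 0`, `δ > 0`, `N ≥ 0`, the
  kernel `Bₙ(v,v_*,ω) = (b̄ χ ψ(⟨·,·⟩))(v - v_*, ω)` is a DiPerna–Lions kernel
  (`IsDiPernaLionsKernel`: the symmetries by the `g`-invariance of `b̄`, the radial cut-off and
  `⟨R_ω z, -ω⟩ = ⟨z, ω⟩`; the growth condition trivially by compact support) and a smooth
  truncated kernel with grazing cut-off `δ` (`IsSmoothTruncatedKernel`), with the formula for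
  `Bₙ(z, 0, ω)` recorded for the convergence proof.

## References

* C. Cercignani, R. Illner, M. Pulvirenti, *The Mathematical Theory of Dilute Gases*, Springer
  (1994), §5.3 Steps 6–7, pp. 145–146.
* R. J. DiPerna, P.-L. Lions, Ann. of Math. 130 (1989), p. 322 (6).
-/

open MeasureTheory Metric Real Set Filter Topology
open scoped InnerProductSpace ENNReal NNReal

noncomputable section

namespace Literature.MathematicalPhysics.KineticTheory

open Literature.Analysis.FluidPDE

variable {E : Type*} [NormedAddCommGroup E] [InnerProductSpace ℝ E] [FiniteDimensional ℝ E]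
  [MeasurableSpace E] [BorelSpace E]

/-! ## The reflection `z ↦ z - 2⟨z,ω⟩ω` -/

section Reflection

omit [FiniteDimensional ℝ E] [MeasurableSpace E] [BorelSpace E] in
/-- The reflection is an involution. [folklore] -/
theorem reflectDir_reflectDir (ω : sphere (0 : E) 1) (z : E) :
    (z - (2 * ⟪z, (ω : E)⟫_ℝ) • (ω : E)) - (2 * ⟪z - (2 * ⟪z, (ω : E)⟫_ℝ) • (ω : E), (ω : E)⟫_ℝ) • (ω : E) = z := by
  rw [inner_sub_left, real_inner_smul_left, real_inner_self_sphere]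
  module

omit [FiniteDimensional ℝ E] [MeasurableSpace E] [BorelSpace E] in
/-- `⟨R_ω z, ω⟩ = -⟨z, ω⟩`. [folklore] -/
theorem inner_reflectDir (ω : sphere (0 : E) 1) (z : E) :
    ⟪z - (2 * ⟪z, (ω : E)⟫_ℝ) • (ω : E), (ω : E)⟫_ℝ = -⟪z, (ω : E)⟫_ℝ := by
  rw [inner_sub_left, real_inner_smul_left, real_inner_self_sphere]; ring

omit [FiniteDimensional ℝ E] [MeasurableSpace E] [BorelSpace E] in
/-- The reflection is an isometry. [folklore] -/
theorem norm_reflectDir (ω : sphere (0 : E) 1) (z : E) :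
    ‖z - (2 * ⟪z, (ω : E)⟫_ℝ) • (ω : E)‖ = ‖z‖ := by
  have h : ‖z - (2 * ⟪z, (ω : E)⟫_ℝ) • (ω : E)‖ ^ 2 = ‖z‖ ^ 2 := by
    rw [← real_inner_self_eq_norm_sq, ← real_inner_self_eq_norm_sq, inner_sub_left, inner_sub_right,
      inner_sub_right, real_inner_smul_left, real_inner_smul_right, real_inner_smul_left,
      real_inner_smul_right, real_inner_self_sphere, real_inner_comm (ω : E) z]
    ring
  nlinarith [norm_nonneg (z - (2 * ⟪z, (ω : E)⟫_ℝ) • (ω : E)), norm_nonneg z,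
    sq_nonneg (‖z - (2 * ⟪z, (ω : E)⟫_ℝ) • (ω : E)‖ - ‖z‖), sq_nonneg (‖z - (2 * ⟪z, (ω : E)⟫_ℝ) • (ω : E)‖ + ‖z‖)]

omit [FiniteDimensional ℝ E] [MeasurableSpace E] [BorelSpace E] in
/-- The reflection in terms of Mathlib's reflection in the line `ℝ ω`: `R_ω z = -(reflection (ℝ ω) z)`.
[folklore] -/
theorem reflectDir_eq_neg_reflection (ω : sphere (0 : E) 1) (z : E) :
    z - (2 * ⟪z, (ω : E)⟫_ℝ) • (ω : E) = -((ℝ ∙ (ω : E)).reflection z) := by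
  rw [Submodule.reflection_apply, Submodule.starProjection_singleton ℝ z, norm_eq_of_mem_sphere,
    real_inner_comm]
  simp only [one_pow, div_one, RCLike.ofReal_real_eq_id, id_eq, neg_sub]
  congr 1
  rw [two_nsmul, ← add_smul]
  ring_nf

/-- The reflection preserves Lebesgue measure. [folklore] -/
theorem measurePreserving_reflectDir (ω : sphere (0 : E) 1) :
    MeasurePreserving (fun z : E => z - (2 * ⟪z, (ω : E)⟫_ℝ) • (ω : E)) volume volume := by
  have h : (fun z : E => z - (2 * ⟪z, (ω : E)⟫_ℝ) • (ω : E)) =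
      (fun z : E => -z) ∘ fun z => (ℝ ∙ (ω : E)).reflection z := by
    funext z; exact reflectDir_eq_neg_reflection ω z
  rw [h]
  exact (Measure.measurePreserving_neg _).comp (ℝ ∙ (ω : E)).reflection.measurePreserving

/-- **The micro-reversibility map `g₁ : (z, ω) ↦ (z - 2⟨z,ω⟩ω, -ω)` preserves `dz dσ`** (skew
product of the reflections over the antipodal map). [folklore] -/
theorem measurePreserving_reflectDir_negDir :
    MeasurePreserving (fun q : E × sphere (0 : E) 1 => (q.1 - (2 * ⟪q.1, (q.2 : E)⟫_ℝ) • (q.2 : E), -q.2))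
      ((volume : Measure E).prod sphereMeasure) ((volume : Measure E).prod sphereMeasure) := by
  haveI := isFiniteMeasure_sphereMeasure (E := E)
  have hgm : Measurable (Function.uncurry fun (ω : sphere (0 : E) 1) (z : E) =>
      z - (2 * ⟪z, (ω : E)⟫_ℝ) • (ω : E)) := by
    refine measurable_snd.sub ((measurable_const.mul ?_).smul (measurable_subtype_coe.comp measurable_fst))
    exact measurable_snd.inner (measurable_subtype_coe.comp measurable_fst)
  have hskew : MeasurePreserving
      (fun q : sphere (0 : E) 1 × E => (-q.1, q.2 - (2 * ⟪q.2, (q.1 : E)⟫_ℝ) • (q.1 : E)))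
      ((sphereMeasure : Measure (sphere (0 : E) 1)).prod (volume : Measure E))
      ((sphereMeasure : Measure (sphere (0 : E) 1)).prod (volume : Measure E)) :=
    measurePreserving_neg_sphere.skew_product hgm
      (ae_of_all _ fun ω => (measurePreserving_reflectDir ω).map_eq)
  have hswap1 : MeasurePreserving (Prod.swap : E × sphere (0 : E) 1 → sphere (0 : E) 1 × E)
      ((volume : Measure E).prod sphereMeasure) ((sphereMeasure : Measure (sphere (0 : E) 1)).prod volume) :=
    Measure.measurePreserving_swap
  have hswap2 : MeasurePreserving (Prod.swap : sphere (0 : E) 1 × E → E × sphere (0 : E) 1)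
      ((sphereMeasure : Measure (sphere (0 : E) 1)).prod volume) ((volume : Measure E).prod sphereMeasure) :=
    Measure.measurePreserving_swap
  have h := (hswap2.comp hskew).comp hswap1
  exact h

/-- **The exchange map `g₂ : (z, ω) ↦ (-z, -ω)` preserves `dz dσ`.** [folklore] -/
theorem measurePreserving_neg_negDir :
    MeasurePreserving (fun q : E × sphere (0 : E) 1 => (-q.1, -q.2))
      ((volume : Measure E).prod sphereMeasure) ((volume : Measure E).prod sphereMeasure) := by
  haveI := isFiniteMeasure_sphereMeasure (E := E)
  exact (Measure.measurePreserving_neg (volume : Measure E)).prod measurePreserving_neg_sphere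

/-- **The composite `g₁ g₂ : (z, ω) ↦ (-(z - 2⟨z,ω⟩ω), ω)` preserves `dz dσ`.** [folklore] -/
theorem measurePreserving_neg_reflectDir :
    MeasurePreserving (fun q : E × sphere (0 : E) 1 => (-(q.1 - (2 * ⟪q.1, (q.2 : E)⟫_ℝ) • (q.2 : E)), q.2))
      ((volume : Measure E).prod sphereMeasure) ((volume : Measure E).prod sphereMeasure) := by
  have h := measurePreserving_reflectDir_negDir.comp (measurePreserving_neg_negDir (E := E))
  have hfun : ((fun q : E × sphere (0 : E) 1 => (q.1 - (2 * ⟪q.1, (q.2 : E)⟫_ℝ) • (q.2 : E), -q.2)) ∘ 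
      fun q : E × sphere (0 : E) 1 => (-q.1, -q.2)) =
      fun q : E × sphere (0 : E) 1 => (-(q.1 - (2 * ⟪q.1, (q.2 : E)⟫_ℝ) • (q.2 : E)), q.2) := by
    funext q
    simp only [Function.comp_apply, neg_neg, Prod.mk.injEq, and_true, coe_neg_sphere, inner_neg_left,
      inner_neg_right, neg_neg, smul_neg]
    abel
  rwa [hfun] at h

end Reflection

/-! ## Symmetrisation does not increase the distance to a symmetric kernel -/

section SymmetriseL1

/-- **Symmetrising over the micro-reversibility group does not increase the `L¹(dz dσ)` distance
to a symmetric kernel**: if `H(z - 2⟨z,ω⟩ω, -ω) = H(z,ω) = H(-z,-ω)`, then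
`∫∫ |¼ Σ_g b∘g - H| ≤ ∫∫ |b - H|` (the four maps preserve `dz dσ`). [folklore] -/
theorem lintegral_abs_symmetrise_sub_le {b : E × E → ℝ} (hbm : Measurable b)
    {H : E × sphere (0 : E) 1 → ℝ} (hHm : Measurable H)
    (hH1 : ∀ (z : E) (ω : sphere (0 : E) 1), H (z - (2 * ⟪z, (ω : E)⟫_ℝ) • (ω : E), -ω) = H (z, ω))
    (hH2 : ∀ (z : E) (ω : sphere (0 : E) 1), H (-z, -ω) = H (z, ω)) :
    ∫⁻ q, ENNReal.ofReal |4⁻¹ * (b (q.1, q.2) + b (q.1 - (2 * ⟪q.1, (q.2 : E)⟫_ℝ) • (q.2 : E), ((-q.2 : sphere (0 : E) 1) : E)) +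
        b (-q.1, ((-q.2 : sphere (0 : E) 1) : E)) + b (-(q.1 - (2 * ⟪q.1, (q.2 : E)⟫_ℝ) • (q.2 : E)), q.2)) - H q|
        ∂((volume : Measure E).prod sphereMeasure) ≤
      ∫⁻ q, ENNReal.ofReal |b (q.1, q.2) - H q| ∂((volume : Measure E).prod sphereMeasure) := by
  haveI := isFiniteMeasure_sphereMeasure (E := E)
  set ν : Measure (E × sphere (0 : E) 1) := (volume : Measure E).prod sphereMeasure with hν
  -- the three nontrivial maps of the group
  set g₁ : E × sphere (0 : E) 1 → E × sphere (0 : E) 1 :=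
    fun q => (q.1 - (2 * ⟪q.1, (q.2 : E)⟫_ℝ) • (q.2 : E), -q.2) with hg₁
  set g₂ : E × sphere (0 : E) 1 → E × sphere (0 : E) 1 := fun q => (-q.1, -q.2) with hg₂
  set g₃ : E × sphere (0 : E) 1 → E × sphere (0 : E) 1 :=
    fun q => (-(q.1 - (2 * ⟪q.1, (q.2 : E)⟫_ℝ) • (q.2 : E)), q.2) with hg₃
  have hmp₁ : MeasurePreserving g₁ ν ν := measurePreserving_reflectDir_negDir
  have hmp₂ : MeasurePreserving g₂ ν ν := measurePreserving_neg_negDir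
  have hmp₃ : MeasurePreserving g₃ ν ν := measurePreserving_neg_reflectDir
  -- the difference and its invariance-corrected form
  set d : E × sphere (0 : E) 1 → ℝ := fun q => b (q.1, q.2) - H q with hd
  have hdm : Measurable fun q => ENNReal.ofReal |d q| :=
    ((hbm.comp (measurable_fst.prodMk (measurable_subtype_coe.comp measurable_snd))).sub hHm).abs.ennreal_ofReal
  have hH3 : ∀ q : E × sphere (0 : E) 1, H (g₃ q) = H q := fun q => by
    have h := hH2 (q.1 - (2 * ⟪q.1, (q.2 : E)⟫_ℝ) • (q.2 : E)) (-q.2)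
    rw [neg_neg] at h
    simp only [hg₃]
    rw [h, hH1]
  have hpt : ∀ q : E × sphere (0 : E) 1,
      ENNReal.ofReal |4⁻¹ * (b (q.1, q.2) + b (q.1 - (2 * ⟪q.1, (q.2 : E)⟫_ℝ) • (q.2 : E), ((-q.2 : sphere (0 : E) 1) : E)) +
        b (-q.1, ((-q.2 : sphere (0 : E) 1) : E)) + b (-(q.1 - (2 * ⟪q.1, (q.2 : E)⟫_ℝ) • (q.2 : E)), q.2)) - H q| ≤
      ENNReal.ofReal 4⁻¹ * (ENNReal.ofReal |d q| + ENNReal.ofReal |d (g₁ q)| + ENNReal.ofReal |d (g₂ q)| +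
        ENNReal.ofReal |d (g₃ q)|) := by
    intro q
    have hid : 4⁻¹ * (b (q.1, q.2) + b (q.1 - (2 * ⟪q.1, (q.2 : E)⟫_ℝ) • (q.2 : E), ((-q.2 : sphere (0 : E) 1) : E)) +
        b (-q.1, ((-q.2 : sphere (0 : E) 1) : E)) + b (-(q.1 - (2 * ⟪q.1, (q.2 : E)⟫_ℝ) • (q.2 : E)), q.2)) - H q =
        4⁻¹ * (d q + d (g₁ q) + d (g₂ q) + d (g₃ q)) := by
      have e1 : H (g₁ q) = H q := hH1 q.1 q.2
      have e2 : H (g₂ q) = H q := hH2 q.1 q.2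
      have e3 := hH3 q
      simp only [hd, hg₁, hg₂, hg₃] at e1 e2 e3 ⊢
      rw [e1, e2, e3]
      ring
    rw [hid, ← ENNReal.ofReal_add (abs_nonneg _) (abs_nonneg _), ← ENNReal.ofReal_add (by positivity) (abs_nonneg _),
      ← ENNReal.ofReal_add (by positivity) (abs_nonneg _), ← ENNReal.ofReal_mul (by norm_num)]
    refine ENNReal.ofReal_le_ofReal ?_
    rw [abs_mul, abs_of_pos (by norm_num : (0 : ℝ) < 4⁻¹)]
    refine mul_le_mul_of_nonneg_left ?_ (by norm_num)
    exact (abs_add_le _ _).trans (add_le_add ((abs_add_le _ _).trans (add_le_add (abs_add_le _ _) le_rfl)) le_rfl)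
  -- integrate
  have hI : ∀ {g : E × sphere (0 : E) 1 → E × sphere (0 : E) 1}, MeasurePreserving g ν ν →
      ∫⁻ q, ENNReal.ofReal |d (g q)| ∂ν = ∫⁻ q, ENNReal.ofReal |d q| ∂ν :=
    fun hg => hg.lintegral_comp hdm
  calc _ ≤ ∫⁻ q, ENNReal.ofReal 4⁻¹ * (ENNReal.ofReal |d q| + ENNReal.ofReal |d (g₁ q)| + ENNReal.ofReal |d (g₂ q)| +
        ENNReal.ofReal |d (g₃ q)|) ∂ν := lintegral_mono hpt
    _ = ENNReal.ofReal 4⁻¹ * (4 * ∫⁻ q, ENNReal.ofReal |d q| ∂ν) := by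
        rw [lintegral_const_mul' _ _ ENNReal.ofReal_ne_top]
        congr 1
        have m0 : Measurable fun q => ENNReal.ofReal |d q| := hdm
        have m1 : Measurable fun q => ENNReal.ofReal |d (g₁ q)| := hdm.comp hmp₁.measurable
        have m2 : Measurable fun q => ENNReal.ofReal |d (g₂ q)| := hdm.comp hmp₂.measurable
        have m01 : Measurable fun q => ENNReal.ofReal |d q| + ENNReal.ofReal |d (g₁ q)| := m0.add m1
        have m012 : Measurable fun q => ENNReal.ofReal |d q| + ENNReal.ofReal |d (g₁ q)| + ENNReal.ofReal |d (g₂ q)| :=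
          m01.add m2
        rw [lintegral_add_left m012, lintegral_add_left m01, lintegral_add_left m0, hI hmp₁, hI hmp₂, hI hmp₃]
        ring
    _ = ∫⁻ q, ENNReal.ofReal |d q| ∂ν := by
        rw [← mul_assoc, ← ENNReal.ofReal_ofNat 4, ← ENNReal.ofReal_mul (by norm_num)]
        norm_num

end SymmetriseL1

/-! ## Smooth cut-offs -/

section Cutoff

omit [FiniteDimensional ℝ E] [MeasurableSpace E] [BorelSpace E] in
/-- **A smooth radial cut-off**: `χ ∈ C^∞(E)`, `0 ≤ χ ≤ 1`, `χ = 1` on `|z| ≤ N`, `χ = 0` for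
`|z| ≥ N + 1`, and `χ` depends on `|z|` only (`χ(z) = smoothTransition(((N+1)² - |z|²)/(2N+1))`).
[folklore] -/
theorem exists_smooth_radial_cutoff {N : ℝ} (hN : 0 ≤ N) :
    ∃ χ : E → ℝ, ContDiff ℝ ((⊤ : ℕ∞) : WithTop ℕ∞) χ ∧ (∀ z, 0 ≤ χ z ∧ χ z ≤ 1) ∧
      (∀ z, ‖z‖ ≤ N → χ z = 1) ∧ (∀ z, N + 1 ≤ ‖z‖ → χ z = 0) ∧
      ∀ z z' : E, ‖z‖ = ‖z'‖ → χ z = χ z' := by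
  refine ⟨fun z => Real.smoothTransition (((N + 1) ^ 2 - ‖z‖ ^ 2) / (2 * N + 1)), ?_, ?_, ?_, ?_, ?_⟩
  · exact Real.smoothTransition.contDiff.comp
      ((contDiff_const.sub (contDiff_norm_sq ℝ)).div_const _)
  · exact fun z => ⟨Real.smoothTransition.nonneg _, Real.smoothTransition.le_one _⟩
  · intro z hz
    refine Real.smoothTransition.one_of_one_le ?_
    rw [le_div_iff₀ (by linarith)]
    nlinarith [norm_nonneg z]
  · intro z hz
    refine Real.smoothTransition.zero_of_nonpos (div_nonpos_of_nonpos_of_nonneg ?_ (by linarith))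
    nlinarith [norm_nonneg z]
  · intro z z' h
    simp only [h]

/-- **A smooth grazing cut-off**: `ψ ∈ C^∞(ℝ)`, `0 ≤ ψ ≤ 1`, `ψ(s) = 0` for `|s| ≤ δ`, `ψ(s) = 1`
for `|s| ≥ 2δ`, `ψ` even (`ψ(s) = smoothTransition((s² - δ²)/(3δ²))`). [folklore] -/
theorem exists_smooth_grazing_cutoff {δ : ℝ} (hδ : 0 < δ) :
    ∃ ψ : ℝ → ℝ, ContDiff ℝ ((⊤ : ℕ∞) : WithTop ℕ∞) ψ ∧ (∀ s, 0 ≤ ψ s ∧ ψ s ≤ 1) ∧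
      (∀ s, |s| ≤ δ → ψ s = 0) ∧ (∀ s, 2 * δ ≤ |s| → ψ s = 1) ∧ ∀ s, ψ (-s) = ψ s := by
  refine ⟨fun s => Real.smoothTransition ((s ^ 2 - δ ^ 2) / (3 * δ ^ 2)), ?_, ?_, ?_, ?_, ?_⟩
  · exact Real.smoothTransition.contDiff.comp (((contDiff_id.pow 2).sub contDiff_const).div_const _)
  · exact fun s => ⟨Real.smoothTransition.nonneg _, Real.smoothTransition.le_one _⟩
  · intro s hs
    refine Real.smoothTransition.zero_of_nonpos (div_nonpos_of_nonpos_of_nonneg ?_ (by positivity))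
    nlinarith [abs_nonneg s, sq_abs s]
  · intro s hs
    refine Real.smoothTransition.one_of_one_le ?_
    rw [le_div_iff₀ (by positivity)]
    nlinarith [abs_nonneg s, sq_abs s]
  · intro s; simp only [neg_sq]

end Cutoff

/-! ## The symmetrised, truncated kernel -/

section Kernel

/-- **Symmetrisation and truncation of a smooth kernel.** Let `b ∈ C^∞(E × E)`, `0 ≤ b ≤ C_b`,
`b(z, y) = 0` for `|z| ≥ R_b`, and `δ > 0`, `N ≥ 0`. Symmetrise `b` over the group
`{id, g₁, g₂, g₁g₂}` of the two micro-reversibility maps `g₁ : (z,ω) ↦ (z - 2⟨z,ω⟩ω, -ω)`,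
`g₂ : (z,ω) ↦ (-z,-ω)` (which encode `B(v',v_*',-ω) = B(v,v_*,ω)` and `B(v_*,v,-ω) = B(v,v_*,ω)`
for Galilean-invariant kernels), and multiply by a radial cut-off `χ` (`= 1` on `|z| ≤ N`, `= 0`
for `|z| ≥ N+1`) and a grazing cut-off `ψ(⟨z,ω⟩)` (`= 0` for `|⟨z,ω⟩| ≤ δ`, `= 1` for
`|⟨z,ω⟩| ≥ 2δ`). The resulting `Bₙ(v, v_*, ω) = (b̄ χ ψ)(v - v_*, ω)` is a bounded DiPerna–Lions
kernel compactly supported in the relative velocity and a smooth truncated kernel with grazing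
cut-off `δ` (CIP 1994 §5.3 Step 6–7: "`qₙ ∈ C_0^∞`, ... `qₙ(z, ω) = 0` if `|z·ω| < δₙ`").
The conclusion records `χ`, `ψ` and the formula for `Bₙ(z, 0, ω)`. [cite: CIPDiluteGases1994, §5.3 Steps 6–7 (pp. 145–146)] -/
theorem exists_symmetrised_truncated_kernel {b : E × E → ℝ}
    (hb : ContDiff ℝ ((⊤ : ℕ∞) : WithTop ℕ∞) b) (hb0 : ∀ p, 0 ≤ b p) {Cb : ℝ} (hbC : ∀ p, b p ≤ Cb)
    {δ : ℝ} (hδ : 0 < δ) {N : ℝ} (hN : 0 ≤ N) :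
    ∃ (B' : E × E → sphere (0 : E) 1 → ℝ) (χ : E → ℝ) (ψ : ℝ → ℝ),
      KineticTheory.IsDiPernaLionsKernel B' ∧ IsSmoothTruncatedKernel δ B' ∧
      (∀ p ω, 0 ≤ B' p ω ∧ B' p ω ≤ Cb) ∧ (∀ (z : E) ω, N + 1 ≤ ‖z‖ → B' (z, 0) ω = 0) ∧
      (∀ z, 0 ≤ χ z ∧ χ z ≤ 1) ∧ (∀ z, ‖z‖ ≤ N → χ z = 1) ∧ (∀ z, N + 1 ≤ ‖z‖ → χ z = 0) ∧
      (∀ s, 0 ≤ ψ s ∧ ψ s ≤ 1) ∧ (∀ s, |s| ≤ δ → ψ s = 0) ∧ (∀ s, 2 * δ ≤ |s| → ψ s = 1) ∧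
      ∀ (z : E) (ω : sphere (0 : E) 1), B' (z, 0) ω =
        4⁻¹ * (b (z, ω) + b (z - (2 * ⟪z, (ω : E)⟫_ℝ) • (ω : E), -ω) + b (-z, -ω) +
          b (-(z - (2 * ⟪z, (ω : E)⟫_ℝ) • (ω : E)), ω)) * χ z * ψ ⟪z, (ω : E)⟫_ℝ := by
  obtain ⟨χ, hχs, hχ01, hχ1, hχ0, hχrad⟩ := exists_smooth_radial_cutoff (E := E) hN
  obtain ⟨ψ, hψs, hψ01, hψ0, hψ1, hψeven⟩ := exists_smooth_grazing_cutoff hδ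
  -- the symmetrised profile on the ambient space and the kernel
  set bs : E × E → ℝ := fun q => 4⁻¹ * (b (q.1, q.2) + b (q.1 - (2 * ⟪q.1, q.2⟫_ℝ) • q.2, -q.2) +
    b (-q.1, -q.2) + b (-(q.1 - (2 * ⟪q.1, q.2⟫_ℝ) • q.2), q.2)) with hbs
  set F : E × E → ℝ := fun q => bs q * χ q.1 * ψ ⟪q.1, q.2⟫_ℝ with hF
  set B' : E × E → sphere (0 : E) 1 → ℝ := fun p ω => F (p.1 - p.2, ω) with hB'
  -- smoothness of the ambient profile
  have hrefl : ContDiff ℝ ((⊤ : ℕ∞) : WithTop ℕ∞) fun q : E × E => q.1 - (2 * ⟪q.1, q.2⟫_ℝ) • q.2 :=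
    contDiff_fst.sub ((contDiff_const.mul (contDiff_fst.inner ℝ contDiff_snd)).smul contDiff_snd)
  have hbs_smooth : ContDiff ℝ ((⊤ : ℕ∞) : WithTop ℕ∞) bs := by
    refine contDiff_const.mul (((?_ : ContDiff ℝ _ _).add ?_).add ?_ |>.add ?_)
    · exact hb.comp (contDiff_fst.prodMk contDiff_snd)
    · exact hb.comp (hrefl.prodMk contDiff_snd.neg)
    · exact hb.comp (contDiff_fst.neg.prodMk contDiff_snd.neg)
    · exact hb.comp (hrefl.neg.prodMk contDiff_snd)
  have hF_smooth : ContDiff ℝ ((⊤ : ℕ∞) : WithTop ℕ∞) F :=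
    (hbs_smooth.mul (hχs.comp contDiff_fst)).mul (hψs.comp (contDiff_fst.inner ℝ contDiff_snd))
  -- elementary bounds
  have hbs0 : ∀ q, 0 ≤ bs q := fun q =>
    mul_nonneg (by norm_num) (add_nonneg (add_nonneg (add_nonneg (hb0 _) (hb0 _)) (hb0 _)) (hb0 _))
  have hbsC : ∀ q, bs q ≤ Cb := fun q => by
    simp only [hbs]
    linarith [hbC (q.1, q.2), hbC (q.1 - (2 * ⟪q.1, q.2⟫_ℝ) • q.2, -q.2), hbC (-q.1, -q.2),
      hbC (-(q.1 - (2 * ⟪q.1, q.2⟫_ℝ) • q.2), q.2)]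
  have hF0 : ∀ q, 0 ≤ F q := fun q => mul_nonneg (mul_nonneg (hbs0 q) (hχ01 _).1) (hψ01 _).1
  have hFC : ∀ q, F q ≤ Cb := fun q => by
    have hCb : 0 ≤ Cb := (hb0 (q.1, q.2)).trans (hbC _)
    calc F q ≤ bs q * χ q.1 * 1 := mul_le_mul_of_nonneg_left (hψ01 _).2 (mul_nonneg (hbs0 q) (hχ01 _).1)
      _ ≤ bs q * 1 * 1 := by gcongr; exacts [hbs0 q, (hχ01 _).2]
      _ ≤ Cb := by simpa using hbsC q
  have hFsupp : ∀ q : E × E, N + 1 ≤ ‖q.1‖ → F q = 0 := fun q hq => by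
    simp only [hF, hχ0 q.1 hq, mul_zero, zero_mul]
  -- the symmetries of the profile on the sphere
  have hsym1 : ∀ (z : E) (ω : sphere (0 : E) 1),
      F (z - (2 * ⟪z, (ω : E)⟫_ℝ) • (ω : E), ((-ω : sphere (0 : E) 1) : E)) = F (z, ω) := by
    intro z ω
    set R : E := z - (2 * ⟪z, (ω : E)⟫_ℝ) • (ω : E) with hR
    have hRR : R - (2 * ⟪R, (ω : E)⟫_ℝ) • (ω : E) = z := reflectDir_reflectDir ω z
    have hIR : ⟪R, (ω : E)⟫_ℝ = -⟪z, (ω : E)⟫_ℝ := inner_reflectDir ω z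
    have hNR : ‖R‖ = ‖z‖ := norm_reflectDir ω z
    have hsmul : (2 * ⟪R, -(ω : E)⟫_ℝ) • (-(ω : E)) = (2 * ⟪R, (ω : E)⟫_ℝ) • (ω : E) := by
      rw [inner_neg_right, smul_neg, mul_neg, neg_smul, neg_neg]
    have hbs_eq : bs (R, -(ω : E)) = bs (z, ω) := by
      simp only [hbs]
      rw [hsmul, hRR, neg_neg]
      ring
    have hχ_eq : χ R = χ z := hχrad _ _ hNR
    have hψ_eq : ⟪R, -(ω : E)⟫_ℝ = ⟪z, (ω : E)⟫_ℝ := by rw [inner_neg_right, hIR, neg_neg]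
    simp only [hF, coe_neg_sphere]
    rw [hbs_eq, hχ_eq, hψ_eq]
  have hsym2 : ∀ (z : E) (ω : sphere (0 : E) 1), F (-z, ((-ω : sphere (0 : E) 1) : E)) = F (z, ω) := by
    intro z ω
    set R : E := z - (2 * ⟪z, (ω : E)⟫_ℝ) • (ω : E) with hR
    have hsmul : -z - (2 * ⟪-z, -(ω : E)⟫_ℝ) • (-(ω : E)) = -R := by
      rw [inner_neg_left, inner_neg_right, neg_neg, smul_neg, hR]; abel
    have hbs_eq : bs (-z, -(ω : E)) = bs (z, ω) := by
      simp only [hbs]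
      rw [hsmul, neg_neg, neg_neg, neg_neg]
      ring
    have hχ_eq : χ (-z) = χ z := hχrad _ _ (norm_neg z)
    have hψ_eq : ⟪-z, -(ω : E)⟫_ℝ = ⟪z, (ω : E)⟫_ℝ := by rw [inner_neg_left, inner_neg_right, neg_neg]
    simp only [hF, coe_neg_sphere]
    rw [hbs_eq, hχ_eq, hψ_eq]
  -- continuity and measurability
  have hFc : Continuous F := hF_smooth.continuous
  have hB'm : Measurable (Function.uncurry B') :=
    (hFc.measurable.comp ((measurable_fst.fst.sub measurable_fst.snd).prodMk
      (measurable_subtype_coe.comp measurable_snd)))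
  -- the relative velocity after a collision
  have hcollide_sub : ∀ (ω : sphere (0 : E) 1) (p : E × E),
      (collide ω p).1 - (collide ω p).2 = (p.1 - p.2) - (2 * ⟪p.1 - p.2, (ω : E)⟫_ℝ) • (ω : E) := by
    intro ω p
    simp only [collide]
    module
  -- the DiPerna–Lions kernel structure
  have hker : KineticTheory.IsDiPernaLionsKernel B' := by
    refine ⟨hB'm, fun p ω => hF0 _, fun v w u ω => by simp only [hB', add_sub_add_right_eq_sub], ?_, ?_, ?_, ?_⟩
    · -- micro-reversibility
      intro p ω
      simp only [hB']
      rw [hcollide_sub]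
      exact hsym1 (p.1 - p.2) ω
    · -- exchange symmetry
      intro p ω
      simp only [hB', Prod.fst_swap, Prod.snd_swap]
      rw [show p.2 - p.1 = -(p.1 - p.2) by abel]
      exact hsym2 (p.1 - p.2) ω
    · -- local integrability
      haveI := isFiniteMeasure_sphereMeasure (E := E)
      have hc : Continuous fun q : E × sphere (0 : E) 1 => B' (q.1, 0) q.2 := by
        simp only [hB', sub_zero]
        exact hFc.comp (continuous_fst.prodMk (continuous_subtype_val.comp continuous_snd))
      exact hc.locallyIntegrable
    · -- the growth condition: the angular integral vanishes for `|z| ≥ N + 1`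
      intro R
      have hev : ∀ᶠ v : E in cocompact E, N + 1 + |R| ≤ ‖v‖ :=
        tendsto_norm_cocompact_atTop.eventually (eventually_ge_atTop _)
      refine tendsto_const_nhds.congr' (hev.mono fun v hv => ?_)
      symm
      rw [mul_eq_zero]; right
      refine setIntegral_eq_zero_of_forall_eq_zero fun z hz => ?_
      rw [mem_closedBall, dist_eq_norm] at hz
      have hz' : N + 1 ≤ ‖z‖ := by
        have h1 : ‖v‖ ≤ ‖z‖ + ‖z - v‖ := by
          calc ‖v‖ = ‖z - (z - v)‖ := by rw [sub_sub_cancel]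
            _ ≤ ‖z‖ + ‖z - v‖ := norm_sub_le _ _
        linarith [le_abs_self R]
      unfold kernelAngularIntegral
      simp only [hB', sub_zero, hFsupp (z, _) hz', integral_zero]
  refine ⟨B', χ, ψ, hker, ?_, fun p ω => ⟨hF0 _, hFC _⟩, fun z ω hz => ?_, hχ01, hχ1, hχ0, hψ01, hψ0, hψ1,
    fun z ω => ?_⟩
  · -- the smooth truncated kernel structure
    refine ⟨hker, ⟨F, hF_smooth, fun p ω => rfl⟩, ⟨N + 1, fun z ω hz => ?_⟩, fun z ω hzω => ?_⟩
    · simp only [hB', sub_zero]; exact hFsupp (z, _) hz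
    · simp only [hB', sub_zero, hF, hψ0 _ hzω.le, mul_zero]
  · simp only [hB', sub_zero]; exact hFsupp (z, _) hz
  · simp only [hB', hF, hbs, sub_zero]

end Kernel

end Literature.MathematicalPhysics.KineticTheory
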